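import Summits.Ventures.CertifiedManyBodySolver.Downfold.TPrimePinnedPairRowKernel
import Summits.Ventures.CertifiedManyBodySolver.Rows.CorrWindowCertKernelIdentity
import HarnessLib

/-!
# The PINNED t′-PAIR shape from TWO SYNTACTIC window certificates sharing ONE equation-of-motion word list:
# `SquareTTPrimePinnedPairRowT.of_kernelCerts` (cell `pub/hubbard-obs` × `pub/hubbard-downfold`, D-0154 (1)(C) COVERAGE La214;
# seat `hubbard-cov-la214-unc-2`, lineage desk; zero compute)

HONEST FRAMING: Lean plumbing towards «tier P» for PAIR claim nodes‴: the identity-level pair link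
`SquareTTPrimePinnedPairRowT.of_windowIdentities` (`Downfold/TPrimePinnedPairRowKernel.lean`, p665976) composed with hubbard-obs-p2's
syntactic kernel machinery (`Rows/CARPolyWindowSyntax.lean`, `…Residual.lean`, `…CorrWindowCertKernelFormGram.lean`,
`…CorrWindowCertKernelIdentity.lean`): the two window IDENTITIES are replaced by two kernel-evaluable rational inequalities on collected
normal forms (captain RULING #5, hubbard-obs STATUS 2026-08-28T20:43:52Z: identity lemma = obs-p2, pair composition = this seat). Nothing is asserted: no `def`, no named fact, no
`sorry`, no number; no claim node is discharged here (that needs the EXPORTER to this data shape + the evaluation of the two inequalities);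
CONTROL / CALIBRATION wording class (xx1); no node of record, tier, word or registry row changes; no summit statement is proved here.

* §1 `SquareTTPrimePinnedPairRowT.of_kernelCerts`: two `residTG` data sets (hubbard-obs-p2, `Rows/CorrWindowCertKernelFormGram.lean`:
  objective `TX_v`, density rows `μ_v/ν_v`, CAP row `κ_v (cap_v·1 − TE_v)`, CUT row `κ_v′ (TE_v − fl_v·1)`, an ABSTRACT Gram term `TG_v`
  with `termOp d TG_v = gramForm Λm_v O_v`, `Λm_v ⪰ 0`, moves, charged words, anti-Hermitian parts) at `sA`, `sB` over the SAME letters with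
  ONE SHARED eom word list `EB` (the pinfold clause, now structural), dictionaries `TH_v ↦ H^{(1,s_v,U)}_{Λ₇}`, `TE_v ↦ ΓE^{(1,s_v,U)}`,
  objectives `termOp d TX_v = X s_v`, and the two inequalities `β_v ≤ lowerConst R_v + (μ_v 0 + μ_v 1)(n₀/2 − ν_v)` on the collected
  normal forms `R_v` ⇒ `SquareTTPrimePinnedPairRowT U n₀ sA sB capA capB flA flB βA κA κA' βB κB κB' X` (rational `U ≥ 0`, `0 ≤ n₀ < 2`,
  `sA`, `sB`; `Λ ⊆ Λ₇ = box 2 7`, `S = D₄`). PROOF: hubbard-obs-p2's identity lemma `CARPolyWindow.windowIdentity_of_residTG` per vertex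
  (with `Hsem := H^{(1,s_v,U)}_{Λ₇}`, `Esem := ΓE^{(1,s_v,U)}`), `constCoeff_sub_sum_norm_resCoeff`, then `…of_windowIdentities` with
  `B_k := termOp dΛ (EB.get k)`;
* §2 `…of_kernelCerts_sos`: the same with hubbard-obs-p2's SOS-factor `residT` data verbatim (`gramT K Q`, `1 ⪰ 0`, `residT_eq_residTG`).

WHAT A USER STILL OWES (per window, as for the single-vertex kernel form): the dictionary equalities `hH_v`, `hE_v`, `hX_v`, the letter-map
equalities `hf`, `hg_v`, `ho`, `hsp`, the geometric side conditions on `box 2 7` — and the evaluation of the two inequalities (tier P3).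
References: J. Wang et al., PRX 14 (2024) 031006 §III [WangEtAl2024]; X. Han, arXiv:2006.06002 §3 [Han2020Bootstrap]; C. Jansson,
D. Chaykin, C. Keil, SIAM J. Numer. Anal. 46 (2008) 180 [JanssonChaykinKeil2008]; D. P. Bertsekas, *Nonlinear Programming* (1999)
Prop. 5.1.3 [Bertsekas1999NonlinearProgramming]; S. Boyd, L. Vandenberghe, *Convex Optimization* (2004) §5.9 [BoydVandenberghe2004].
-/

noncomputable section

namespace Summit.Ventures.CertifiedManyBodySolver.Downfold

open Literature.MathematicalPhysics.QuantumLattice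
open Matrix HubbardWave0 Literature.Probability.LatticeModels ThermodynamicLimit Filter Topology
open Literature.MathematicalPhysics.QuantumManyBody.StateRelaxation
open Summit.Ventures.CertifiedQuantumChemistry Summit.Ventures.CertifiedQuantumChemistry.CARPoly
open Summit.Ventures.CertifiedManyBodySolver.CARPolyWindow
open scoped BigOperators ComplexOrder

/-! ## §1  TWO syntactic certificates (`residTG` data) with ONE shared eom word list ⇒ the pinned t′-pair shape -/

section KernelPair

variable {α β : Type*} [LinearOrder α]

/-- **KERNEL FORM OF THE PAIR NODE‴.** Square lattice, `t = 1`, rational `U ≥ 0`, density `0 ≤ n₀ < 2`, hoppings `sA`, `sB`; window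
`Λ ⊆ Λ₇ = box 2 7`; letters `d` (injective, with spins `sp`), inner letters `dΛ`/`f`, origin letters `o`; an objective family
`X : ℝ → 𝔄_{Λ₇}`; ONE SHARED eom word list `EB`. For each vertex `v ∈ {A, B}`: dictionaries `TH_v` / `TE_v` at `(1, s_v, U)`, an objective
term list `TX_v` with `termOp d TX_v = X s_v`, density multipliers `μ_v`, slot `ν_v`, cap row `(κ_v, cap_v)`, cut row `(κ_v′, fl_v)`, an
abstract Gram term `TG_v` (`termOp d TG_v = gramForm Λm_v O_v`, `Λm_v ⪰ 0`), moves `(γ_v, wv_v, g_v)` on inner words `SY_v`, charged words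
`CW_v` (charges decided on the syntax), anti-Hermitian parts `AV_v`, the collected normal form `R_v` of the residual list, and ONE rational
inequality `β_v ≤ lowerConst R_v + (μ_v 0 + μ_v 1)(n₀/2 − ν_v)` (decidable). THEN
`SquareTTPrimePinnedPairRowT U n₀ sA sB capA capB flA flB βA κA κA′ βB κB κB′ X`.
So a pinned pair of exported vertex certificates (hub′ folded + pinned spoke carry the same eom multipliers — here: the same `EB`) IS the
pair claim node‴, with no pair-level computation: two `lowerConst (normalize …)` evaluations. [cite: WangEtAl2024, §III]
[cite: JanssonChaykinKeil2008, §3] [cite: Bertsekas1999NonlinearProgramming, Prop. 5.1.3] -/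
theorem SquareTTPrimePinnedPairRowT.of_kernelCerts
    (U : ℚ) (hU : 0 ≤ U) (n₀ : ℚ) (hn0 : 0 ≤ n₀) (hn2 : n₀ < 2) (sA sB : ℚ)
    {Λ : Finset (Site 2)} (hΛ : Λ ⊆ box 2 7) (h8 : thicken Λ 1 ⊆ box 2 7)
    (h0 : thicken ({0} : Finset (Site 2)) 1 ⊆ box 2 7) (hz : (0 : Site 2) ∈ box 2 7)
    -- letters (shared)
    (d : α → Orb (PolySite (box 2 7))) (hd : Function.Injective d) (enc : α → ℕ) (Bkey : ℕ)
    (dΛ : β → Orb (PolySite Λ)) (f : β → α) (hf : ∀ b, d (f b) = Orb.embMap (PolySite.incl hΛ) (dΛ b))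
    (sp : α → Fin 2) (hsp : ∀ a, (ofLex (d a)).2 = sp a)
    (o : Fin 2 → α) (ho : ∀ σ, d (o σ) = orb (PolySite.pt 0 hz) σ)
    -- the objective family and the SHARED eom words
    (X : ℝ → FermionOp (box 2 7)) (EB : List (Terms β))
    -- vertex A
    (THA : Terms α) (hHA : termOp d THA = (hubbardTTPrimeFermionInteraction 1 (sA : ℝ) (U : ℝ)).localHamiltonian (box 2 7))
    (TEA : Terms α)
    (hEA : termOp d TEA = fermionEmbed (PolySite.incl h0) ((hubbardTTPrimeFermionInteraction 1 (sA : ℝ) (U : ℝ)).meanEnergyObs 1))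
    (TXA : Terms α) (hXA : termOp d TXA = X (sA : ℝ)) (μA : Fin 2 → ℚ) (νA κA capA κA' flA : ℚ)
    (TGA : Terms α) {mA : Type*} [Fintype mA] [DecidableEq mA] {ΛmA : Matrix mA mA ℂ} (hΛmA : ΛmA.PosSemidef)
    (OA : mA → FermionOp (box 2 7)) (hGA : termOp d TGA = gramForm ΛmA OA)
    {nSA : ℕ} (γA : Fin nSA → DihedralGroup 4) (wvA : Fin nSA → Site 2) (hshA : ∀ l, d4ShiftSet (γA l) (wvA l) Λ ⊆ box 2 7)
    (gA : Fin nSA → β → α)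
    (hgA : ∀ l b, d (gA l b) = Orb.embMap (PolySite.incl (hshA l)) (Orb.embMap (PolySite.d4Emb (γA l) (wvA l) Λ) (dΛ b)))
    (SYA : Fin nSA → Terms β) (CWA : Terms α) (hcwA : ∀ wc ∈ CWA, chargeW wc.1 ≠ 0 ∨ spinChargeW sp wc.1 ≠ 0) (AVA : List (Terms α))
    {RA : CARPoly.Poly α}
    (hRA : CARPoly.normalize enc Bkey (residTG TXA μA νA o κA capA κA' flA TEA TGA THA f EB gA SYA CWA AVA) = RA)
    {βA : ℚ} (hβA : βA ≤ lowerConst RA + (μA 0 + μA 1) * (n₀ / 2 - νA))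
    -- vertex B
    (THB : Terms α) (hHB : termOp d THB = (hubbardTTPrimeFermionInteraction 1 (sB : ℝ) (U : ℝ)).localHamiltonian (box 2 7))
    (TEB : Terms α)
    (hEB : termOp d TEB = fermionEmbed (PolySite.incl h0) ((hubbardTTPrimeFermionInteraction 1 (sB : ℝ) (U : ℝ)).meanEnergyObs 1))
    (TXB : Terms α) (hXB : termOp d TXB = X (sB : ℝ)) (μB : Fin 2 → ℚ) (νB κB capB κB' flB : ℚ)
    (TGB : Terms α) {mB : Type*} [Fintype mB] [DecidableEq mB] {ΛmB : Matrix mB mB ℂ} (hΛmB : ΛmB.PosSemidef)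
    (OB : mB → FermionOp (box 2 7)) (hGB : termOp d TGB = gramForm ΛmB OB)
    {nSB : ℕ} (γB : Fin nSB → DihedralGroup 4) (wvB : Fin nSB → Site 2) (hshB : ∀ l, d4ShiftSet (γB l) (wvB l) Λ ⊆ box 2 7)
    (gB : Fin nSB → β → α)
    (hgB : ∀ l b, d (gB l b) = Orb.embMap (PolySite.incl (hshB l)) (Orb.embMap (PolySite.d4Emb (γB l) (wvB l) Λ) (dΛ b)))
    (SYB : Fin nSB → Terms β) (CWB : Terms α) (hcwB : ∀ wc ∈ CWB, chargeW wc.1 ≠ 0 ∨ spinChargeW sp wc.1 ≠ 0) (AVB : List (Terms α))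
    {RB : CARPoly.Poly α}
    (hRB : CARPoly.normalize enc Bkey (residTG TXB μB νB o κB capB κB' flB TEB TGB THB f EB gB SYB CWB AVB) = RB)
    {βB : ℚ} (hβB : βB ≤ lowerConst RB + (μB 0 + μB 1) * (n₀ / 2 - νB)) :
    SquareTTPrimePinnedPairRowT (U : ℝ) (n₀ : ℝ) (sA : ℝ) (sB : ℝ) capA capB flA flB βA κA κA' βB κB κB' X := by
  have hUr : (0 : ℝ) ≤ ((U : ℚ) : ℝ) := by exact_mod_cast hU
  have hn0r : (0 : ℝ) ≤ ((n₀ : ℚ) : ℝ) := by exact_mod_cast hn0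
  have hn2r : ((n₀ : ℚ) : ℝ) < 2 := by exact_mod_cast hn2
  -- (1) the two window identities, on the objectives `X sA`, `X sB`
  have hcertA := CARPolyWindow.windowIdentity_of_residTG hΛ hz d hd enc Bkey dΛ f hf THA _ hHA TEA _ hEA o ho TXA μA νA κA
    capA κA' flA TGA ΛmA OA hGA EB γA wvA hshA gA hgA SYA CWA AVA hRA
  rw [hXA] at hcertA
  have hcertB := CARPolyWindow.windowIdentity_of_residTG hΛ hz d hd enc Bkey dΛ f hf THB _ hHB TEB _ hEB o ho TXB μB νB κB
    capB κB' flB TGB ΛmB OB hGB EB γB wvB hshB gB hgB SYB CWB AVB hRB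
  rw [hXB] at hcertB
  -- (2) the charged words are charged (decided on the syntax)
  have hcwA' := CARPolyWindow.charged_of_hcw d sp hsp CWA hcwA
  have hcwB' := CARPolyWindow.charged_of_hcw d sp hsp CWB hcwB
  -- (3) the prices are the engine's `lowerConst`
  have hβA' : ((βA : ℚ) : ℝ) ≤ ((constCoeff RA : ℚ) : ℝ) - ∑ k ∈ (Finset.univ : Finset (Fin RA.length)), ‖resCoeff RA k‖ +
      (∑ σ : Fin 2, ((μA σ : ℚ) : ℝ)) * (((n₀ : ℚ) : ℝ) / 2 - ((νA : ℚ) : ℝ)) := by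
    rw [constCoeff_sub_sum_norm_resCoeff RA, Fin.sum_univ_two]
    have h2 : ((βA : ℚ) : ℝ) ≤ (((lowerConst RA + (μA 0 + μA 1) * (n₀ / 2 - νA) : ℚ)) : ℝ) := by exact_mod_cast hβA
    push_cast at h2
    linarith
  have hβB' : ((βB : ℚ) : ℝ) ≤ ((constCoeff RB : ℚ) : ℝ) - ∑ k ∈ (Finset.univ : Finset (Fin RB.length)), ‖resCoeff RB k‖ +
      (∑ σ : Fin 2, ((μB σ : ℚ) : ℝ)) * (((n₀ : ℚ) : ℝ) / 2 - ((νB : ℚ) : ℝ)) := by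
    rw [constCoeff_sub_sum_norm_resCoeff RB, Fin.sum_univ_two]
    have h2 : ((βB : ℚ) : ℝ) ≤ (((lowerConst RB + (μB 0 + μB 1) * (n₀ / 2 - νB) : ℚ)) : ℝ) := by exact_mod_cast hβB
    push_cast at h2
    linarith
  -- (4) the identity-level pair theorem, with the SHARED eom words `B_k := termOp dΛ (EB.get k)`
  exact SquareTTPrimePinnedPairRowT.of_windowIdentities hUr hn0r hn2r (sA : ℝ) (sB : ℝ) hΛ h8 h0 hz X
    (Finset.univ : Finset (Fin EB.length)) (fun k => termOp dΛ (EB.get k))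
    (fun σ => ((μA σ : ℚ) : ℝ)) ((νA : ℚ) : ℝ) capA flA κA κA' hΛmA OA Finset.univ γA wvA hshA (fun l => termOp dΛ (SYA l))
    Finset.univ (fun j => (((CWA.get j).2 : ℚ) : ℂ)) (fun j => wmap d (CWA.get j).1) hcwA' Finset.univ (fun _ => (1 : ℝ))
    (fun m' => termOp d (AVA.get m')) Finset.univ (resCoeff RA) (resWord d RA) hcertA hβA'
    (fun σ => ((μB σ : ℚ) : ℝ)) ((νB : ℚ) : ℝ) capB flB κB κB' hΛmB OB Finset.univ γB wvB hshB (fun l => termOp dΛ (SYB l))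
    Finset.univ (fun j => (((CWB.get j).2 : ℚ) : ℂ)) (fun j => wmap d (CWB.get j).1) hcwB' Finset.univ (fun _ => (1 : ℝ))
    (fun m' => termOp d (AVB.get m')) Finset.univ (resCoeff RB) (resWord d RB) hcertB hβB'

end KernelPair

/-! ## §2  The SOS-factor (`gramT`) edition: hubbard-obs-p2's `residT` data verbatim, twice, with ONE shared `EB` -/

section KernelPairSOS

variable {α β : Type*} [LinearOrder α]

/-- **KERNEL FORM OF THE PAIR NODE‴, SOS-FACTOR GRAM (`residT` edition).** As `SquareTTPrimePinnedPairRowT.of_kernelCerts` with each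
Gram term in hubbard-obs-p2's SOS-factor form `gramT K_v Q_v` (PSD by construction, `termOp_gramT_eq_gramForm`), i.e. with the residual
of each vertex literally `residT TX_v μ_v ν_v o κ_v cap_v κ_v' fl_v TE_v K_v Q_v TH_v f EB g_v SY_v CW_v AV_v`
(`Rows/CorrWindowCertKernelForm.lean`) — the SAME `EB` in both. [cite: WangEtAl2024, §III] [cite: JanssonChaykinKeil2008, §3] -/
theorem SquareTTPrimePinnedPairRowT.of_kernelCerts_sos
    (U : ℚ) (hU : 0 ≤ U) (n₀ : ℚ) (hn0 : 0 ≤ n₀) (hn2 : n₀ < 2) (sA sB : ℚ)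
    {Λ : Finset (Site 2)} (hΛ : Λ ⊆ box 2 7) (h8 : thicken Λ 1 ⊆ box 2 7)
    (h0 : thicken ({0} : Finset (Site 2)) 1 ⊆ box 2 7) (hz : (0 : Site 2) ∈ box 2 7)
    (d : α → Orb (PolySite (box 2 7))) (hd : Function.Injective d) (enc : α → ℕ) (Bkey : ℕ)
    (dΛ : β → Orb (PolySite Λ)) (f : β → α) (hf : ∀ b, d (f b) = Orb.embMap (PolySite.incl hΛ) (dΛ b))
    (sp : α → Fin 2) (hsp : ∀ a, (ofLex (d a)).2 = sp a)
    (o : Fin 2 → α) (ho : ∀ σ, d (o σ) = orb (PolySite.pt 0 hz) σ)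
    (X : ℝ → FermionOp (box 2 7)) (EB : List (Terms β))
    -- vertex A
    (THA : Terms α) (hHA : termOp d THA = (hubbardTTPrimeFermionInteraction 1 (sA : ℝ) (U : ℝ)).localHamiltonian (box 2 7))
    (TEA : Terms α)
    (hEA : termOp d TEA = fermionEmbed (PolySite.incl h0) ((hubbardTTPrimeFermionInteraction 1 (sA : ℝ) (U : ℝ)).meanEnergyObs 1))
    (TXA : Terms α) (hXA : termOp d TXA = X (sA : ℝ)) (μA : Fin 2 → ℚ) (νA κA capA κA' flA : ℚ) (KA : ℕ) (QA : List (Terms α))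
    {nSA : ℕ} (γA : Fin nSA → DihedralGroup 4) (wvA : Fin nSA → Site 2) (hshA : ∀ l, d4ShiftSet (γA l) (wvA l) Λ ⊆ box 2 7)
    (gA : Fin nSA → β → α)
    (hgA : ∀ l b, d (gA l b) = Orb.embMap (PolySite.incl (hshA l)) (Orb.embMap (PolySite.d4Emb (γA l) (wvA l) Λ) (dΛ b)))
    (SYA : Fin nSA → Terms β) (CWA : Terms α) (hcwA : ∀ wc ∈ CWA, chargeW wc.1 ≠ 0 ∨ spinChargeW sp wc.1 ≠ 0) (AVA : List (Terms α))
    {RA : CARPoly.Poly α}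
    (hRA : CARPoly.normalize enc Bkey (residT TXA μA νA o κA capA κA' flA TEA KA QA THA f EB gA SYA CWA AVA) = RA)
    {βA : ℚ} (hβA : βA ≤ lowerConst RA + (μA 0 + μA 1) * (n₀ / 2 - νA))
    -- vertex B
    (THB : Terms α) (hHB : termOp d THB = (hubbardTTPrimeFermionInteraction 1 (sB : ℝ) (U : ℝ)).localHamiltonian (box 2 7))
    (TEB : Terms α)
    (hEB : termOp d TEB = fermionEmbed (PolySite.incl h0) ((hubbardTTPrimeFermionInteraction 1 (sB : ℝ) (U : ℝ)).meanEnergyObs 1))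
    (TXB : Terms α) (hXB : termOp d TXB = X (sB : ℝ)) (μB : Fin 2 → ℚ) (νB κB capB κB' flB : ℚ) (KB : ℕ) (QB : List (Terms α))
    {nSB : ℕ} (γB : Fin nSB → DihedralGroup 4) (wvB : Fin nSB → Site 2) (hshB : ∀ l, d4ShiftSet (γB l) (wvB l) Λ ⊆ box 2 7)
    (gB : Fin nSB → β → α)
    (hgB : ∀ l b, d (gB l b) = Orb.embMap (PolySite.incl (hshB l)) (Orb.embMap (PolySite.d4Emb (γB l) (wvB l) Λ) (dΛ b)))
    (SYB : Fin nSB → Terms β) (CWB : Terms α) (hcwB : ∀ wc ∈ CWB, chargeW wc.1 ≠ 0 ∨ spinChargeW sp wc.1 ≠ 0) (AVB : List (Terms α))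
    {RB : CARPoly.Poly α}
    (hRB : CARPoly.normalize enc Bkey (residT TXB μB νB o κB capB κB' flB TEB KB QB THB f EB gB SYB CWB AVB) = RB)
    {βB : ℚ} (hβB : βB ≤ lowerConst RB + (μB 0 + μB 1) * (n₀ / 2 - νB)) :
    SquareTTPrimePinnedPairRowT (U : ℝ) (n₀ : ℝ) (sA : ℝ) (sB : ℝ) capA capB flA flB βA κA κA' βB κB κB' X :=
  SquareTTPrimePinnedPairRowT.of_kernelCerts U hU n₀ hn0 hn2 sA sB hΛ h8 h0 hz d hd enc Bkey dΛ f hf sp hsp o ho X EB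
    THA hHA TEA hEA TXA hXA μA νA κA capA κA' flA (gramT KA QA) (posSemidef_one_fin QA.length) (gramOp d KA QA)
    (termOp_gramT_eq_gramForm d KA QA) γA wvA hshA gA hgA SYA CWA hcwA AVA (by rw [← residT_eq_residTG]; exact hRA) hβA
    THB hHB TEB hEB TXB hXB μB νB κB capB κB' flB (gramT KB QB) (posSemidef_one_fin QB.length) (gramOp d KB QB)
    (termOp_gramT_eq_gramForm d KB QB) γB wvB hshB gB hgB SYB CWB hcwB AVB (by rw [← residT_eq_residTG]; exact hRB) hβB

end KernelPairSOS

end Summit.Ventures.CertifiedManyBodySolver.Downfold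

end
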